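import Summits.AnomalousDissipation.AnomalousDissipation.Theorems.SolenoidalFractalHomogenisationLagrangianStepCellClauseModWDefs
import Summits.AnomalousDissipation.AnomalousDissipation.Theorems.SolenoidalFractalHomogenisationLagrangianStepVmodFlatBlocks
import HarnessLib

/-!
# K1L_D (stmt-AnomalousDissipation-27980), (ℓ3-A): the DISTORTED block architecture of the modulated slow-vector clause — texts (definitions only)
(Summits-side definitions file of route `SolenoidalFractalHomogenisation`; review lane; prover lead-k1l-onelevel-p1 g6, tenure RULING D27-15 T1 on memo L18
`Cruxes/…/Lines/onelevel-L18-ell3-architecture.md` §3; certifier planner ad-ideate-p5 g14 regimes memo v5 §7 (T-θ1…T-θ4, O-4, O-5).)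

The (ℓ3) plan of record (D27-15) re-runs the (ℓ2) block ARCHITECTURE of prover ad-sawtooth-k1loc-p1 g14 (`…VmodFlatBlocks{,E,EVH}`: split data and tests at the
frequency ball `freqBall (n/4)` into slow/fast FLAT Fourier classes, four blocks, one assembly) for a DISTORTED pair: a modulation datum `G`
(`CellClauseMod.IsModulation θ Tw nC G`: `G(0) = 1`, `|G−1| ≤ θ`, `det = 1`, Piola columns, `|∇G| ≤ θ·nC`, `∫|∂_τG| ≤ θ`) and the two distorted propagators
`U` (cell member: drift `cellField`, tensor `(1/n²)𝔸`) and `T` (coarse member: no drift, tensor `(1/n²)(𝔸 + (c/ν)Φ_ν((1/ν)𝔸))`) of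
`CellClauseMod.IsDistortedPropagator`.  Only windows that start at the frame reset `s = 0` are stated (finding F-p1g14-5: the §9z glue consumes nothing else;
`G(0) = 1` so the data classes are the flat ones).  This file DEFINES:
* `SlowVectorClauseModECW0` — `CellClauseMod.SlowVectorClauseModECW` (v26's `stub_Vmod_of_VRH` conclusion) RESTRICTED to `s = 0`; the (ℓ3-A) assembly's
  output; it still implies the EulerPiece obligation `Z7Glue.Vmod_E_textHT` through the frame (companion `…VmodDistortedAssembly`: `vmod_E_of_modW0`).
* `BlockBoundG … θ₁ ϱ₁ Px Pζ` — the common DISTORTED block shape: `SlowVectorClauseModECW0`'s binders with data restricted by `Px n x`, tests by `Pζ n ζ`.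
* `NearMultG c Φ … θ₁ ϱ₁ κ` — the distorted COARSE member (word-independent: only the coarse tensor enters) is `κ`-close to a Fourier multiplier IN LOSS CURRENCY: for Fourier-disjoint slow `xs` / fast `xf`,
  `|⟪T 0 t xs, T 0 t xf⟫| ≤ κ·√lossFwd(T 0 t) xs·√lossFwd(T 0 t) xf` and the adjoint twin — it replaces the flat input (F0) `CoarseSupp_text` (exact support
  preservation, false for `G ≢ 1`) and is what makes the two losses SUB-additive over the split (`q(xs) + q(xf) ≤ q(xs+xf)/(1−κ)`); a coarse-member-only
  statement (drift-free both sides: certifier T-θ1/T-θ3, memo L18 (O1) «benign»).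
* §3 **(V_θ)** `SlowVectorClauseFθ … θV` — the single-slow-mode cell law (V) (`SlowVectorClauseNoExF`, no existence conjunct) for the compact family of CONSTANT
  unimodular deformations `G₀`, `|G₀ − 1| ≤ θV`, in the tree's ISOMETRIC reading (`Torus.IsWeakTensorPassiveVectorDistortedOn … (fun _ _ => G₀)`: flat `L²`
  metric, flat lattice drift `cellField`, constraint `∇·(G₀·) = 0`, tensor conjugated inside the class; datum `Re e_ℓ • p` with `⟪G₀ p, ℓ⟫ = 0`) — certifier
  O-5 / Q1 sign-off 2026-08-29T09:17:05Z, tenure RULINGS D27-16/16′ (hypothesis swap: threaded AFTER the (V) line); `G₀ = 1` recovers (V)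
  (`of_one_toFlat` / `toDistorted_one`); crux idea `Cruxes/LagrangianRenormalisationStep/Ideas/vtheta-deformed-cell-law.md`;
  (`Vmod_E_textHTθ e` — `Z7Glue.Vmod_E_textHT` with the (V_θ) binder after (V) — lands with the glue sibling `cellInputs_BIL_ofEulerθ`); `FrozenDistortedExists … θV` — the S-support
  text N1 (existence of frozen-`G₀` distorted-class solutions of the cell member from single-mode data; affine pull-back of the flat Galerkin theory).
The block TEXTS with the (V)/(V_θ)/W7 prefixes follow in the assembly's wrapper once the 5-text threading (D27-16 Q2) is cut by the tenure; the pointwise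
assembly `modECW0_of_blockBoundsG_at` (companion `…VmodDistortedAssembly`) is binder-agnostic.
Definitions only; NOT a proof of anything; K1L_D open; AD NOT proved; rung F-D1.A0.
-/

set_option linter.dupNamespace false

noncomputable section

namespace Summit.AnomalousDissipation.AnomalousDissipation.Theorems.SolenoidalFractalHomogenisation.LagrangianStep.VmodDist

open Literature.Analysis Literature.Analysis.FluidPDE Literature.Analysis.FunctionSpaces
open MeasureTheory Set
open scoped InnerProductSpace
open Summit.AnomalousDissipation.AnomalousDissipation.Theorems.SolenoidalFractalHomogenisation.LagrangianStep.CellClauseMod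
open Summit.AnomalousDissipation.AnomalousDissipation.Theorems.SolenoidalFractalHomogenisation.LagrangianStep.VmodFlat (IsSlow IsFast)

/-! ## §1 The modulated clause on reset-anchored windows -/

/-- **(V_modECW0)** — `CellClauseMod.SlowVectorClauseModECW` restricted to windows `[0, t]` that start at the frame reset (`G(0) = 1`): same binders
(quasi-static `ν`, resolution, the two tensor windows incl. the coarse-image binders, `θ ∈ [0,θ₁]`, `nC ≤ ϱ₁ n`, `Tw`, modulation datum `G`, distorted
propagators `U`, `T`), conclusion for `0 < t ≤ Tw` and all `x ζ : V2`:
`|⟪U 0 t x − T 0 t x, ζ⟫| ≤ (C(C(ν^σ + (⌈K/ν⌉/n)^σ + θ^σ + (nC/n)^σ) + (min 1 ((M·Wp/ν)/t))^σ))·√lossFwd (T 0 t) x·√lossAdj (T 0 t) ζ`.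
(Finding F-p1g14-5: the §9z glue calls the clause only at `s = 0`.) [cite: ArmstrongVicol2025, §4.1 (PDF p. 34)] -/
def SlowVectorClauseModECW0 {k : ℕ} (W : LatticeShear.LatticeWord k) (M : ℝ) (hM : 0 < M) (c : ℝ)
    (Φ : ℝ → Torus.Visc4 (Fin 3) → Torus.Visc4 (Fin 3)) (lo hi Λ β σ C ν₀ K θ₁ ϱ₁ : ℝ) : Prop :=
  ∀ ν, ∀ hν : ν ∈ Set.Ioo 0 ν₀, ∀ n : ℕ, (⌈K / ν⌉₊ : ℝ) ≤ n → ∀ 𝔸 : Torus.Visc4 (Fin 3),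
    Torus.OddSmall 𝔸 (ν * β) → (∃ lam ∈ Set.Icc (1:ℝ) Λ, Torus.NearIso 𝔸 (ν * (lo / lam)) (ν * (hi * lam))) →
    Torus.OddSmall (Φ ν ((1 / ν) • 𝔸)) β → (∃ lam ∈ Set.Icc (1:ℝ) Λ, Torus.NearIso (Φ ν ((1 / ν) • 𝔸)) (lo / lam) (hi * lam)) →
    ∀ θ ∈ Set.Icc 0 θ₁, ∀ nC : ℝ, 0 ≤ nC → nC ≤ ϱ₁ * n → ∀ Tw > (0:ℝ),
    ∀ G : ℝ → UnitAddTorus (Fin 3) → Matrix (Fin 3) (Fin 3) ℝ, IsModulation θ Tw nC G →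
    ∀ U T : ℝ → ℝ → (V2 →L[ℝ] V2),
      IsDistortedPropagator Tw ((1 / (n:ℝ) ^ 2) • 𝔸) (cellField W M hM ν hν.1 n) G U →
      IsDistortedPropagator Tw ((1 / (n:ℝ) ^ 2) • (𝔸 + (c / ν) • Φ ν ((1 / ν) • 𝔸))) (fun _ _ => 0) G T →
    ∀ t : ℝ, 0 < t → t ≤ Tw → ∀ x ζ : V2,
      |⟪U 0 t x - T 0 t x, ζ⟫_ℝ|
        ≤ (C * (C * (ν ^ σ + ((⌈K / ν⌉₊ : ℝ) / n) ^ σ + θ ^ σ + (nC / n) ^ σ) + (min 1 ((M * W.period / ν) / t)) ^ σ))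
          * Real.sqrt (lossFwd (T 0 t) x) * Real.sqrt (lossAdj (T 0 t) ζ)

/-- `ModECW ⇒ ModECW0` (take `s = 0`). -/
theorem modECW0_of_modECW {k : ℕ} {W : LatticeShear.LatticeWord k} {M : ℝ} {hM : 0 < M} {c : ℝ}
    {Φ : ℝ → Torus.Visc4 (Fin 3) → Torus.Visc4 (Fin 3)} {lo hi Λ β σ C ν₀ K θ₁ ϱ₁ : ℝ}
    (h : SlowVectorClauseModECW W M hM c Φ lo hi Λ β σ C ν₀ K θ₁ ϱ₁) : SlowVectorClauseModECW0 W M hM c Φ lo hi Λ β σ C ν₀ K θ₁ ϱ₁ := by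
  intro ν hν n hn 𝔸 hodd hwin hΦo hΦw θ hθ nC hnC0 hnC Tw hTw G hG U T hU hT t ht0 htT x ζ
  have key := h ν hν n hn 𝔸 hodd hwin hΦo hΦw θ hθ nC hnC0 hnC Tw hTw G hG U T hU hT 0 t le_rfl ht0 htT x ζ
  rw [sub_zero] at key
  exact key

/-! ## §2 The distorted block shape and the near-multiplier input -/

/-- **The common DISTORTED block shape**: `SlowVectorClauseModECW0` with its data restricted by `Px n x` and its tests by `Pζ n ζ` (the classes are
FLAT Fourier-support classes of the frame-label fields — `G(0) = 1` at the reset). -/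
def BlockBoundG {k : ℕ} (W : LatticeShear.LatticeWord k) (M : ℝ) (hM : 0 < M) (c : ℝ)
    (Φ : ℝ → Torus.Visc4 (Fin 3) → Torus.Visc4 (Fin 3)) (lo hi Λ β σ Cb ν₀ K θ₁ ϱ₁ : ℝ) (Px Pζ : ℕ → V2 → Prop) : Prop :=
  ∀ ν, ∀ hν : ν ∈ Set.Ioo 0 ν₀, ∀ n : ℕ, (⌈K / ν⌉₊ : ℝ) ≤ n → ∀ 𝔸 : Torus.Visc4 (Fin 3),
    Torus.OddSmall 𝔸 (ν * β) → (∃ lam ∈ Set.Icc (1:ℝ) Λ, Torus.NearIso 𝔸 (ν * (lo / lam)) (ν * (hi * lam))) →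
    Torus.OddSmall (Φ ν ((1 / ν) • 𝔸)) β → (∃ lam ∈ Set.Icc (1:ℝ) Λ, Torus.NearIso (Φ ν ((1 / ν) • 𝔸)) (lo / lam) (hi * lam)) →
    ∀ θ ∈ Set.Icc 0 θ₁, ∀ nC : ℝ, 0 ≤ nC → nC ≤ ϱ₁ * n → ∀ Tw > (0:ℝ),
    ∀ G : ℝ → UnitAddTorus (Fin 3) → Matrix (Fin 3) (Fin 3) ℝ, IsModulation θ Tw nC G →
    ∀ U T : ℝ → ℝ → (V2 →L[ℝ] V2),
      IsDistortedPropagator Tw ((1 / (n:ℝ) ^ 2) • 𝔸) (cellField W M hM ν hν.1 n) G U →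
      IsDistortedPropagator Tw ((1 / (n:ℝ) ^ 2) • (𝔸 + (c / ν) • Φ ν ((1 / ν) • 𝔸))) (fun _ _ => 0) G T →
    ∀ t : ℝ, 0 < t → t ≤ Tw → ∀ x ζ : V2, Px n x → Pζ n ζ →
      |⟪U 0 t x - T 0 t x, ζ⟫_ℝ|
        ≤ (Cb * (Cb * (ν ^ σ + ((⌈K / ν⌉₊ : ℝ) / n) ^ σ + θ ^ σ + (nC / n) ^ σ) + (min 1 ((M * W.period / ν) / t)) ^ σ))
          * Real.sqrt (lossFwd (T 0 t) x) * Real.sqrt (lossAdj (T 0 t) ζ)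

/-- **(M_θ) the distorted coarse member is `κ`-close to a Fourier multiplier in LOSS CURRENCY** (replaces the flat input (F0) `VmodFlat.CoarseSupp_text`):
for every modulation datum and distorted coarse propagator `T` as in `SlowVectorClauseModECW0`, every `0 < t ≤ Tw`, and every Fourier-disjoint pair
(slow `xs`, fast `xf`): `|⟪T 0 t xs, T 0 t xf⟫| ≤ κ·√lossFwd (T 0 t) xs·√lossFwd (T 0 t) xf` and `|⟪T† ζs, T† ζf⟫| ≤ κ·√lossAdj (T 0 t) ζs·√lossAdj (T 0 t) ζf`
(for a multiplier `κ = 0`; the assembly needs `κ < 1`; certifier T-θ1/T-θ3: the scattered part of a slow mode under the drift-free distorted coarse flow is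
of the size of its own loss). -/
def NearMultG (c : ℝ) (Φ : ℝ → Torus.Visc4 (Fin 3) → Torus.Visc4 (Fin 3)) (lo hi Λ β ν₀ K θ₁ ϱ₁ κ : ℝ) : Prop :=
  ∀ ν : ℝ, ν ∈ Set.Ioo 0 ν₀ → ∀ n : ℕ, (⌈K / ν⌉₊ : ℝ) ≤ n → ∀ 𝔸 : Torus.Visc4 (Fin 3),
    Torus.OddSmall 𝔸 (ν * β) → (∃ lam ∈ Set.Icc (1:ℝ) Λ, Torus.NearIso 𝔸 (ν * (lo / lam)) (ν * (hi * lam))) →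
    Torus.OddSmall (Φ ν ((1 / ν) • 𝔸)) β → (∃ lam ∈ Set.Icc (1:ℝ) Λ, Torus.NearIso (Φ ν ((1 / ν) • 𝔸)) (lo / lam) (hi * lam)) →
    ∀ θ ∈ Set.Icc 0 θ₁, ∀ nC : ℝ, 0 ≤ nC → nC ≤ ϱ₁ * n → ∀ Tw > (0:ℝ),
    ∀ G : ℝ → UnitAddTorus (Fin 3) → Matrix (Fin 3) (Fin 3) ℝ, IsModulation θ Tw nC G →
    ∀ T : ℝ → ℝ → (V2 →L[ℝ] V2),
      IsDistortedPropagator Tw ((1 / (n:ℝ) ^ 2) • (𝔸 + (c / ν) • Φ ν ((1 / ν) • 𝔸))) (fun _ _ => 0) G T →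
    ∀ t : ℝ, 0 < t → t ≤ Tw →
      (∀ xs xf : V2, IsSlow n xs → IsFast n xf →
        |⟪T 0 t xs, T 0 t xf⟫_ℝ| ≤ κ * Real.sqrt (lossFwd (T 0 t) xs) * Real.sqrt (lossFwd (T 0 t) xf)) ∧
      (∀ ζs ζf : V2, IsSlow n ζs → IsFast n ζf →
        |⟪ContinuousLinearMap.adjoint (T 0 t) ζs, ContinuousLinearMap.adjoint (T 0 t) ζf⟫_ℝ|
          ≤ κ * Real.sqrt (lossAdj (T 0 t) ζs) * Real.sqrt (lossAdj (T 0 t) ζf))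

/-! ## §3 (V_θ): the single-slow-mode cell law for the family of constant unimodular deformations (certifier O-5; RULINGS D27-16/16′) -/

/-- **(V_θ) `SlowVectorClauseFθ … θV`** — the slow-vector cell clause (V) WITHOUT its existence conjunct (`SlowVectorClauseNoExF`, p1 r24 F2(a)) stated for
every CONSTANT unimodular deformation `G₀` with `|G₀ − 1| ≤ θV` entrywise, in the ISOMETRIC frame reading of the tree's distorted weak class: the cell member
`w` solves `Torus.IsWeakTensorPassiveVectorDistortedOn 0 T ((1/n²)𝔸) (cellField …) (fun _ _ => G₀) datum` (flat lattice drift — exact by `IsInserted` —,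
constraint `∇·(G₀ w) = 0`, tensor conjugated inside the class), the coarse member `v` the same with no drift and the renormalised tensor, the datum is the
single real mode `Re e_ℓ • p` made `G₀`-solenoidal (`⟪G₀ p, ℓ⟫ = 0`, coercions as in `Torus.distort`), and the conclusion is (V)'s VERBATIM (constants
`C, σ` uniform over the family).  `θV = 0` forces `G₀ = 1` and gives (V) back (`IsWeakTensorPassiveVectorDistortedOn.of_one_toFlat`, `….toDistorted_one`).
Frozen `G₀` = EXACTLY the flat cell problem of the affinely deformed word (wavevectors `G₀⁻ᵀm_j`, amplitudes `G₀⁻¹ê_j`).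
[cite: ArmstrongVicol2025, §4.1 (PDF p. 34: the distortion-adapted cell problem)] -/
def SlowVectorClauseFθ {k : ℕ} (W : LatticeShear.LatticeWord k) (M : ℝ) (hM : 0 < M) (c : ℝ)
    (Φ : ℝ → Torus.Visc4 (Fin 3) → Torus.Visc4 (Fin 3)) (lo hi Λ β σ C ν₀ K θV : ℝ) : Prop :=
  ∀ G₀ : Matrix (Fin 3) (Fin 3) ℝ, G₀.det = 1 → (∀ i j, |G₀ i j - (1 : Matrix (Fin 3) (Fin 3) ℝ) i j| ≤ θV) →
      ∀ ν, ∀ hν : ν ∈ Set.Ioo 0 ν₀, ∀ n : ℕ, ∀ 𝔸 : Torus.Visc4 (Fin 3),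
        Torus.OddSmall 𝔸 (ν * β) → (∃ lam ∈ Set.Icc (1:ℝ) Λ, Torus.NearIso 𝔸 (ν * (lo / lam)) (ν * (hi * lam))) →
        ∀ ℓ : Fin 3 → ℤ, ℓ ≠ 0 → ‖Torus.latticeVec ℓ‖ * (⌈K / ν⌉₊ : ℝ) ≤ n →
        ∀ p : EuclideanSpace ℝ (Fin 3), ‖p‖ = 1 →
          ⟪(WithLp.toLp 2 (G₀.mulVec (WithLp.ofLp p)) : EuclideanSpace ℝ (Fin 3)), Torus.latticeVec ℓ⟫_ℝ = 0 →
        ∀ T > (0:ℝ),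
          ∀ w v : ℝ → VF,
            Torus.IsWeakTensorPassiveVectorDistortedOn 0 T ((1 / (n:ℝ) ^ 2) • 𝔸) (cellField W M hM ν hν.1 n) (fun _ _ => G₀)
                (fun x => (UnitAddTorus.mFourier ℓ x).re • p) w →
            Torus.IsWeakTensorPassiveVectorDistortedOn 0 (2 * T) ((1 / (n:ℝ) ^ 2) • (𝔸 + (c / ν) • Φ ν ((1 / ν) • 𝔸))) (fun _ _ => 0) (fun _ _ => G₀)
                (fun x => (UnitAddTorus.mFourier ℓ x).re • p) v →
            ∀ᵐ t ∂(volume.restrict (Ioo 0 T)),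
              2 * ∑ i, ‖modeCoeff ℓ (fun x => w t x - v t x) i‖ ^ 2
                  ≤ (C * (C * (ν ^ σ + (‖Torus.latticeVec ℓ‖ * (⌈K / ν⌉₊ : ℝ) / n) ^ σ) * min 1 ((8 * Real.pi ^ 2 * ‖Torus.latticeVec ℓ‖ ^ 2 * (hi * Λ) * (ν + c / ν) / (n:ℝ) ^ 2) * t) + (8 * Real.pi ^ 2 * ‖Torus.latticeVec ℓ‖ ^ 2 * (hi * Λ) * (ν + c / ν) / (n:ℝ) ^ 2) * (M * W.period / ν))) ^ 2
                      * ∫ x, ‖(UnitAddTorus.mFourier ℓ x).re • p‖ ^ 2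

/-- **N1 (S-support text of the (ℓ3) line, certifier 09:15:09Z / D27-16′): EXISTENCE of frozen-`G₀` distorted-class solutions of the cell member** from
every `G₀`-solenoidal single real mode (for `G₀ = 1` this is `Torus.exists_isWeakTensorPassiveVectorOn`; in general the affine pull-back of the flat
Galerkin/Lions theory).  Not used by `SlowVectorClauseFθ` (which, like `SlowVectorClauseNoExF`, is vacuous without solutions) but by the (ℓ3-B) provers who
must PRODUCE frozen members to compare with. -/
def FrozenDistortedExists {k : ℕ} (W : LatticeShear.LatticeWord k) (M : ℝ) (hM : 0 < M) (ν₀ K θV : ℝ) : Prop :=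
  ∀ G₀ : Matrix (Fin 3) (Fin 3) ℝ, G₀.det = 1 → (∀ i j, |G₀ i j - (1 : Matrix (Fin 3) (Fin 3) ℝ) i j| ≤ θV) →
      ∀ ν, ∀ hν : ν ∈ Set.Ioo 0 ν₀, ∀ n : ℕ, ∀ 𝔸 : Torus.Visc4 (Fin 3), ∀ lo' > (0:ℝ), ∀ hi' : ℝ, Torus.NearIso 𝔸 lo' hi' →
        ∀ ℓ : Fin 3 → ℤ, ℓ ≠ 0 → ‖Torus.latticeVec ℓ‖ * (⌈K / ν⌉₊ : ℝ) ≤ n →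
        ∀ p : EuclideanSpace ℝ (Fin 3), ‖p‖ = 1 →
          ⟪(WithLp.toLp 2 (G₀.mulVec (WithLp.ofLp p)) : EuclideanSpace ℝ (Fin 3)), Torus.latticeVec ℓ⟫_ℝ = 0 →
        ∀ T > (0:ℝ), ∃ w : ℝ → VF,
          Torus.IsWeakTensorPassiveVectorDistortedOn 0 T ((1 / (n:ℝ) ^ 2) • 𝔸) (cellField W M hM ν hν.1 n) (fun _ _ => G₀)
            (fun x => (UnitAddTorus.mFourier ℓ x).re • p) w


/-! ## AMENDMENT 2 (RULING D28-3, 2026-08-29; prover lead-k1l-onelevel-p1 g6): the GRADED (V_θ) text of record `SlowVectorClauseFθg`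

FINDING F-p5g15-1 (certifier planner ad-ideate-p5 g15, memo `Cruxes/LagrangianRenormalisationStep/Lines/onelevel-vtheta-falsifier.md`):
`SlowVectorClauseFθ … θV` above is FALSE for every `θV > 0` on the design instance — its allowance
`C(C(ν^σ + ρ_ℓ^σ) min(1,Rt) + R·P)` carries no `θ`-term and → 0 as `ν → 0`, while the deformed cell word's realised slow symbol differs from
the undeformed coarse tensor `Φ ν ((1/ν)•𝔸)` by a ν-FREE relative `O(θ)` (E = 1.38e-2 at `ℓ = (1,1,0)`, `θ = 0.05`).  It STAYS declared (it is
live and correct at `θV = 0`: `clauseFθ_zero_of_noExF` / `noExF_of_clauseFθ`, …VmodThetaRung) but is DEAD VOCABULARY for `θV > 0` — nobody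
instantiates it there.  REPAIR R1 (RULING D28-3, text of record = the certifier's copy-ready `Lines/onelevel_vtheta_graded.lean`, VERBATIM below):
grade the family by the actual entrywise deformation `θ ∈ [0, θV]` and pay `θ ^ σ` inside the `min 1 (R t)` bracket.
ERRATUM (ad-ref g92 W6, certifier (5)): in the docstring of `SlowVectorClauseFθ` above read "wavevectors `G₀ᵀ m_j`, amplitudes `G₀⁻¹ ê_j`"
(the invariant pairing is `(G₀⁻¹ê) · (G₀ᵀ m) = ê · m`; `G₀⁻ᵀ` there is a transpose slip).
NOT a proof of (V), (V_θ) or K1L_D; AD NOT proved; rung F-D1.A0. -/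

/-- **(V_θ) GRADED `SlowVectorClauseFθg … θV`** — `SlowVectorClauseFθ` with (i) the family graded by the actual entrywise deformation
`θ ∈ [0, θV]` of `G₀` and (ii) the deformation allowance `θ ^ σ` added to `ν ^ σ + ρ_ℓ ^ σ` inside the `min 1 (R t)` bracket (the secular
symbol-mismatch drift of the deformed cell word against the undeformed coarse tensor; true even with `θ` linear).  At `θ = 0` (so `G₀ = 1`,
`0 ^ σ = 0`) it is (V)'s conclusion verbatim. -/
def SlowVectorClauseFθg {k : ℕ} (W : LatticeShear.LatticeWord k) (M : ℝ) (hM : 0 < M) (c : ℝ)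
    (Φ : ℝ → Torus.Visc4 (Fin 3) → Torus.Visc4 (Fin 3)) (lo hi Λ β σ C ν₀ K θV : ℝ) : Prop :=
  ∀ θ ∈ Set.Icc 0 θV, ∀ G₀ : Matrix (Fin 3) (Fin 3) ℝ, G₀.det = 1 → (∀ i j, |G₀ i j - (1 : Matrix (Fin 3) (Fin 3) ℝ) i j| ≤ θ) →
      ∀ ν, ∀ hν : ν ∈ Set.Ioo 0 ν₀, ∀ n : ℕ, ∀ 𝔸 : Torus.Visc4 (Fin 3),
        Torus.OddSmall 𝔸 (ν * β) → (∃ lam ∈ Set.Icc (1:ℝ) Λ, Torus.NearIso 𝔸 (ν * (lo / lam)) (ν * (hi * lam))) →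
        ∀ ℓ : Fin 3 → ℤ, ℓ ≠ 0 → ‖Torus.latticeVec ℓ‖ * (⌈K / ν⌉₊ : ℝ) ≤ n →
        ∀ p : EuclideanSpace ℝ (Fin 3), ‖p‖ = 1 →
          ⟪(WithLp.toLp 2 (G₀.mulVec (WithLp.ofLp p)) : EuclideanSpace ℝ (Fin 3)), Torus.latticeVec ℓ⟫_ℝ = 0 →
        ∀ T > (0:ℝ),
          ∀ w v : ℝ → VF,
            Torus.IsWeakTensorPassiveVectorDistortedOn 0 T ((1 / (n:ℝ) ^ 2) • 𝔸) (cellField W M hM ν hν.1 n) (fun _ _ => G₀)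
                (fun x => (UnitAddTorus.mFourier ℓ x).re • p) w →
            Torus.IsWeakTensorPassiveVectorDistortedOn 0 (2 * T) ((1 / (n:ℝ) ^ 2) • (𝔸 + (c / ν) • Φ ν ((1 / ν) • 𝔸))) (fun _ _ => 0) (fun _ _ => G₀)
                (fun x => (UnitAddTorus.mFourier ℓ x).re • p) v →
            ∀ᵐ t ∂(volume.restrict (Ioo 0 T)),
              2 * ∑ i, ‖modeCoeff ℓ (fun x => w t x - v t x) i‖ ^ 2
                  ≤ (C * (C * (ν ^ σ + (‖Torus.latticeVec ℓ‖ * (⌈K / ν⌉₊ : ℝ) / n) ^ σ + θ ^ σ) * min 1 ((8 * Real.pi ^ 2 * ‖Torus.latticeVec ℓ‖ ^ 2 * (hi * Λ) * (ν + c / ν) / (n:ℝ) ^ 2) * t) + (8 * Real.pi ^ 2 * ‖Torus.latticeVec ℓ‖ ^ 2 * (hi * Λ) * (ν + c / ν) / (n:ℝ) ^ 2) * (M * W.period / ν))) ^ 2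
                      * ∫ x, ‖(UnitAddTorus.mFourier ℓ x).re • p‖ ^ 2

/-- The graded family is antitone in the radius `θV` (certifier's lemma, verbatim). [folklore] -/
theorem SlowVectorClauseFθg.mono_θV {k : ℕ} {W : LatticeShear.LatticeWord k} {M : ℝ} {hM : 0 < M} {c : ℝ}
    {Φ : ℝ → Torus.Visc4 (Fin 3) → Torus.Visc4 (Fin 3)} {lo hi Λ β σ C ν₀ K θV θV' : ℝ} (hle : θV' ≤ θV)
    (h : SlowVectorClauseFθg W M hM c Φ lo hi Λ β σ C ν₀ K θV) : SlowVectorClauseFθg W M hM c Φ lo hi Λ β σ C ν₀ K θV' :=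
  fun θ hθ => h θ ⟨hθ.1, hθ.2.trans hle⟩

/-- The graded (V_θ) clause is monotone in the threshold: a smaller `ν₀'` is implied (twin of `SlowVectorClauseFθ.mono_ν₀`; it is the
`hX` of `Z7Glue.cellInputs_BIL_ofEulerX` at `X := Z7Glue.Xθg`). [folklore] -/
theorem SlowVectorClauseFθg.mono_ν₀ {k : ℕ} {W : LatticeShear.LatticeWord k} {M : ℝ} {hM : 0 < M} {c : ℝ}
    {Ψ : ℝ → Torus.Visc4 (Fin 3) → Torus.Visc4 (Fin 3)} {lo hi Λ β σ C ν₀ ν₀' K θV : ℝ} (hle : ν₀' ≤ ν₀)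
    (h : SlowVectorClauseFθg W M hM c Ψ lo hi Λ β σ C ν₀ K θV) :
    SlowVectorClauseFθg W M hM c Ψ lo hi Λ β σ C ν₀' K θV := by
  intro θ hθ G₀ hdet hG ν hν n 𝔸 hodd hwin ℓ hℓ hres p hp hpl T hT w v hw hv
  have hν' : ν ∈ Set.Ioo 0 ν₀ := ⟨hν.1, hν.2.trans_le hle⟩
  exact h θ hθ G₀ hdet hG ν hν' n 𝔸 hodd hwin ℓ hℓ hres p hp hpl T hT w v hw hv

/-- The graded (V_θ) clause only evaluates the shape map on `(0, ν₀)`: maps agreeing there satisfy it simultaneously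
(twin of `SlowVectorClauseFθ.congr_Ioo`, for the design glue). [folklore] -/
theorem SlowVectorClauseFθg.congr_Ioo {k : ℕ} {W : LatticeShear.LatticeWord k} {M : ℝ} {hM : 0 < M} {c : ℝ}
    {Ψ Ψ' : ℝ → Torus.Visc4 (Fin 3) → Torus.Visc4 (Fin 3)} {lo hi Λ β σ C ν₀ K θV : ℝ} (heq : ∀ ν ∈ Set.Ioo 0 ν₀, Ψ ν = Ψ' ν)
    (h : SlowVectorClauseFθg W M hM c Ψ lo hi Λ β σ C ν₀ K θV) :
    SlowVectorClauseFθg W M hM c Ψ' lo hi Λ β σ C ν₀ K θV := by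
  intro θ hθ G₀ hdet hG ν hν n 𝔸 hodd hwin ℓ hℓ hres p hp hpl T hT w v hw hv
  rw [← heq ν hν] at hv
  exact h θ hθ G₀ hdet hG ν hν n 𝔸 hodd hwin ℓ hℓ hres p hp hpl T hT w v hw hv

end Summit.AnomalousDissipation.AnomalousDissipation.Theorems.SolenoidalFractalHomogenisation.LagrangianStep.VmodDist

end
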